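import Mathlib

/-!
# Squares of non-identity elements of a cyclic group (Theorem N5.T2, case (iii-inert))

Theorem N5.T2 of `route/TIER5.md` §N5.11.5, case (iii-inert), sub-case `s = −ε₀`, needs at
least TWO admissible values of the product `Ξ_v = λ̃²` as `λ` runs over the non-trivial
characters of the cyclic group `k_E^×/k_F^×` of order `q + 1 ≥ 3`, so that `Ξ_v ≠ ξ_{A,v}^{-1}`
can be arranged: «`Ξ_v` ranges over the squares of `Λ ∖ {1}`, a set of `≥ 2` values (`q + 1`
odd: squaring is a bijection of `Λ`, giving `Λ ∖ {1}`, `q ≥ 2` values; `q + 1` even: the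
subgroup `Λ²` of squares, of order `(q+1)/2 ≥ 2` because `q` is then odd, hence `≥ 3`)».

This file checks the count for ANY cyclic group `Λ` of order `≥ 3`, without the parity split:

* `card_filter_sq_eq_le_two`: every fibre of squaring has at most two elements (the solutions
  of `h² = 1` in a cyclic group number at most `2`, Mathlib's `IsCyclic.card_pow_eq_one_le`);
* `card_le_two_mul_card_image_sq`: `|Λ| ≤ 2 · |Λ²|`;
* `two_le_card_image_sq_of_ne_one`: the set `{λ² : λ ≠ 1}` has at least two elements when
  `|Λ| ≥ 3` (if some `λ ≠ 1` squares to `1`, the set is all of `Λ²`, of size `≥ |Λ|/2 ≥ 2`;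
  otherwise squaring is injective and the set has `|Λ| − 1 ≥ 2` elements);
* `card_image_sq_eq_of_odd`: for `|Λ|` odd, squaring is a bijection (`powCoprime`), so the set
  has exactly `|Λ| − 1` elements — the prose's first alternative.

Cyclicity is essential: in `(ℤ/2)²` every non-identity element squares to `1`.
Declaration per README §8(d): «uses an L-value-free non-vanishing device: NO».
-/

namespace Summit.Ventures.HodgeRepro2.T5CyclicSquares

variable {G : Type*} [CommGroup G] [Fintype G] [DecidableEq G]

/-- In a cyclic group every fibre of `g ↦ g ^ 2` has at most two elements. -/
theorem card_filter_sq_eq_le_two [IsCyclic G] (b : G) :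
    (Finset.univ.filter fun g : G => g ^ 2 = b).card ≤ 2 := by
  by_cases hb : ∃ g₀ : G, g₀ ^ 2 = b
  · obtain ⟨g₀, hg₀⟩ := hb
    calc (Finset.univ.filter fun g : G => g ^ 2 = b).card
        ≤ (Finset.univ.filter fun h : G => h ^ 2 = 1).card := by
          refine Finset.card_le_card_of_injOn (fun g => g₀⁻¹ * g) ?_ ?_
          · intro g hg
            simp only [Finset.coe_filter, Finset.mem_univ, true_and, Set.mem_setOf_eq] at hg ⊢
            rw [mul_pow, hg, inv_pow, hg₀, inv_mul_cancel]
          · intro g _ g' _ h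
            exact mul_left_cancel h
      _ ≤ 2 := IsCyclic.card_pow_eq_one_le two_pos
  · push Not at hb
    have h0 : (Finset.univ.filter fun g : G => g ^ 2 = b) = ∅ := by
      ext g
      simp [hb g]
    rw [h0, Finset.card_empty]
    exact Nat.zero_le _

/-- `|G| ≤ 2 · |{g² : g ∈ G}|` for a cyclic group `G`. -/
theorem card_le_two_mul_card_image_sq [IsCyclic G] :
    Fintype.card G ≤ 2 * (Finset.univ.image fun g : G => g ^ 2).card := by
  rw [← Finset.card_univ]
  exact Finset.card_le_mul_card_image _ 2 (fun b _ => card_filter_sq_eq_le_two b)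

/-- The squares of the non-identity elements: `{g² : g ≠ 1}`. -/
theorem two_le_card_image_sq_of_ne_one [IsCyclic G] (h3 : 3 ≤ Fintype.card G) :
    2 ≤ ((Finset.univ.filter fun g : G => g ≠ 1).image fun g : G => g ^ 2).card := by
  by_cases hsq : ∃ g : G, g ≠ 1 ∧ g ^ 2 = 1
  · -- some non-identity element squares to `1`: the image is all of `G²`
    obtain ⟨g₁, hg₁, hg₁'⟩ := hsq
    have himg : (Finset.univ.image fun g : G => g ^ 2) ⊆
        (Finset.univ.filter fun g : G => g ≠ 1).image fun g : G => g ^ 2 := by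
      intro b hb
      obtain ⟨g, _, rfl⟩ := Finset.mem_image.1 hb
      by_cases hg : g = 1
      · subst hg
        exact Finset.mem_image.2 ⟨g₁, by simp [hg₁], by rw [hg₁', one_pow]⟩
      · exact Finset.mem_image.2 ⟨g, by simp [hg], rfl⟩
    have h2 := card_le_two_mul_card_image_sq (G := G)
    have h4 := Finset.card_le_card himg
    omega
  · -- squaring is injective: the image has `|G| − 1` elements
    push Not at hsq
    have hinj : Set.InjOn (fun g : G => g ^ 2) ↑(Finset.univ.filter fun g : G => g ≠ 1) := by
      intro g _ g' _ h
      simp only at h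
      have hq : (g * g'⁻¹) ^ 2 = 1 := by
        rw [mul_pow, h, inv_pow, mul_inv_cancel]
      by_contra hne
      exact hsq (g * g'⁻¹) (by rwa [ne_eq, mul_inv_eq_one]) hq
    rw [Finset.card_image_of_injOn hinj, Finset.filter_ne', Finset.card_erase_of_mem
      (Finset.mem_univ _), Finset.card_univ]
    omega

/-- For `|G|` odd, squaring is a bijection of `G`, so `{g² : g ≠ 1}` has exactly `|G| − 1`
elements (the prose's first alternative, `q + 1` odd). -/
theorem card_image_sq_eq_of_odd (hodd : Odd (Fintype.card G)) :
    ((Finset.univ.filter fun g : G => g ≠ 1).image fun g : G => g ^ 2).card =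
      Fintype.card G - 1 := by
  have hcop : (Nat.card G).Coprime 2 := by
    rw [Nat.card_eq_fintype_card]
    exact Nat.coprime_two_right.2 hodd
  have hinj : Function.Injective fun g : G => g ^ 2 := (powCoprime hcop).injective
  rw [Finset.card_image_of_injective _ hinj, Finset.filter_ne', Finset.card_erase_of_mem
    (Finset.mem_univ _), Finset.card_univ]

end Summit.Ventures.HodgeRepro2.T5CyclicSquares
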